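import Mathlib
import Summits.QuantumFields.YangMills.Theses.TransverseWardBL

/-!
# TransverseWardBL — the cut-free assembly `Assembly3` and the glue `HalfBoundOfCut` (LINE g9-C, docking port)

`TransverseHalfBound` (the cut-free transverse half-bound `β·W_β[f_v²] ≤ ½|v|²` for co-closed zero-sum `v`,
`β > β₁`, all `M`) is the ONLY input the torus helicity-gap node needs from the hard side of route
`route-QuantumFields-TransverseWardBL`: `Assembly3 : TorusMeanPlaqLower → BoxSecondMoment → BoxHodgeSplit →
WardPinning → ZeroModeProjection → SMSubadd → InfraredBound → TransverseHalfBound → U1HelicityGapTorusD4` is proved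
here by the arithmetic of `transverseWardBL_assembly2` (`δ = 1/10`, `η = 1/100`, `M₀(N) ≥ 10100·#B_N`), and
`HalfBoundOfCut : ConvexPhaseCoexactBound → LargeFieldInsensitivity → TransverseHalfBound` records that the route's
own cut decomposition (items 23103, 22928) is one way to supply it. Any other proof of `TransverseHalfBound` — e.g. a
dual-current stiffness bound on co-exact test forms (route WilsonVillainDualStiffness) — closes the node through
`Assembly3`. No summit and no crux is proved here. [folklore]
-/

namespace Summit.QuantumFields.YangMills.Theorems

open Summit.QuantumFields.YangMills.Theses.TransverseWardBL in
/-- The route's cut decomposition supplies the half-bound: `(9/20 + 1/20)·cutMass`-sandwich, divided by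
`cutMass > 0`. [folklore] -/
theorem transverseWardBL_halfBoundOfCut : Summit.QuantumFields.YangMills.Theses.TransverseWardBL.HalfBoundOfCut := by
  intro h2a h2b
  obtain ⟨b₁, hb₁⟩ := h2a
  obtain ⟨b₂, hb₂⟩ := h2b
  refine ⟨max b₁ b₂, fun β hβ M v hvcc hvz => ?_⟩
  have hβ1 : b₁ < β := lt_of_le_of_lt (le_max_left _ _) hβ
  have hβ2 : b₂ < β := lt_of_le_of_lt (le_max_right _ _) hβ
  obtain ⟨hZpos, h2a'⟩ := hb₁ β hβ1 M v hvcc hvz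
  have h2b' := abs_le.mp (hb₂ β hβ2 M v hvcc)
  refine le_of_mul_le_mul_right ?_ hZpos
  linarith [h2b'.1, h2b'.2, h2a']

open Summit.QuantumFields.YangMills.Theses.TransverseWardBL in
/-- The cut-free assembly of route TransverseWardBL holds: the seven soft items and `TransverseHalfBound` imply the
torus helicity-gap node with `δ = 1/10`. [folklore] -/
theorem transverseWardBL_assembly3 : Summit.QuantumFields.YangMills.Theses.TransverseWardBL.Assembly3 := by
  intro h4 h0 h3 h1 hZ hS hI hH
  obtain ⟨b₁, hb₁⟩ := hH
  obtain ⟨b₃, hb₃⟩ := h4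
  refine ⟨max b₁ (max b₃ 1), fun β hβ => ?_⟩
  have hβ1 : b₁ < β := lt_of_le_of_lt (le_max_left _ _) hβ
  have hβ3 : b₃ < β := lt_of_le_of_lt ((le_max_left _ _).trans (le_max_right _ _)) hβ
  have hβpos : 0 < β :=
    lt_of_lt_of_le one_pos (le_of_lt (lt_of_le_of_lt ((le_max_right _ _).trans (le_max_right _ _)) hβ))
  refine ⟨1 / 10, by norm_num, ?_⟩
  obtain ⟨N₀, hN₀⟩ := h3 (1 / 20) (by norm_num)
  refine ⟨N₀, fun N hN => ?_⟩
  obtain ⟨M₀, hM₀⟩ := hN₀ N hN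
  refine ⟨max M₀ (10100 * (Literature.Probability.LatticeModels.box 4 N).card), fun M hM => ?_⟩
  have hM' : M₀ ≤ M := le_trans (le_max_left _ _) hM
  have hMB : 10100 * (Literature.Probability.LatticeModels.box 4 N).card ≤ M := le_trans (le_max_right _ _) hM
  obtain ⟨α, u, hsplit, hcc, hA, hB⟩ := hM₀ M hM'
  obtain ⟨hvcc, hvz, hvle, hw⟩ := hZ M N α u hsplit hcc
  set n : ℝ := ((Literature.Probability.LatticeModels.box 4 N).card : ℝ) with hn_def
  have hn : (0 : ℝ) ≤ n := by positivity
  have e0 := h0 β M N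
  have hfun : (fun p : Literature.MathematicalPhysics.QuantumFieldTheory.Plaquette 4 (M + 1) => (if p.2.1 = ((0 : Fin 4), (1 : Fin 4)) then (((Literature.Probability.LatticeModels.box 4 N).filter (fun x => (fun i => ((x i : ℤ) : ZMod (M + 1))) = p.1)).card : ℝ) else 0)) = (fun p : Literature.MathematicalPhysics.QuantumFieldTheory.Plaquette 4 (M + 1) => Literature.MathematicalPhysics.QuantumFieldTheory.LatticeForm.res (Literature.MathematicalPhysics.QuantumFieldTheory.LatticeForm.td₁ α) p + u p) := funext hsplit
  have e1 := h1 β hβpos M α u hcc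
  rw [← hfun] at e1
  -- transverse, zero-mode-free part `v = zmf u`
  have hT' : β * ((fun (β : ℝ) (M : ℕ) (w : Literature.MathematicalPhysics.QuantumFieldTheory.Plaquette 4 (M + 1) → ℝ) => Literature.MathematicalPhysics.QuantumFieldTheory.wilsonExpectation (L := M + 1) Literature.MathematicalPhysics.QuantumLattice.u1Rep β (fun U : Literature.MathematicalPhysics.QuantumFieldTheory.GaugeConfig 4 (M + 1) Circle => (∑ p : Literature.MathematicalPhysics.QuantumFieldTheory.Plaquette 4 (M + 1), (w) p * ((Literature.MathematicalPhysics.QuantumFieldTheory.plaquetteHolonomy U p.1 p.2.1.1 p.2.1.2 : Circle) : ℂ).im) ^ 2)) β M ((fun (M : ℕ) (u : Literature.MathematicalPhysics.QuantumFieldTheory.Plaquette 4 (M + 1) → ℝ) (p : Literature.MathematicalPhysics.QuantumFieldTheory.Plaquette 4 (M + 1)) => u p - (∑ q : Literature.MathematicalPhysics.QuantumFieldTheory.Plaquette 4 (M + 1), (if q.2 = p.2 then u q else 0)) / (((M : ℝ) + 1) ^ 4)) M u)) ≤ (1 / 2 : ℝ) * (∑ p : Literature.MathematicalPhysics.QuantumFieldTheory.Plaquette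 4 (M + 1), ((((fun (M : ℕ) (u : Literature.MathematicalPhysics.QuantumFieldTheory.Plaquette 4 (M + 1) → ℝ) (p : Literature.MathematicalPhysics.QuantumFieldTheory.Plaquette 4 (M + 1)) => u p - (∑ q : Literature.MathematicalPhysics.QuantumFieldTheory.Plaquette 4 (M + 1), (if q.2 = p.2 then u q else 0)) / (((M : ℝ) + 1) ^ 4)) M u)) p) ^ 2) :=
    hb₁ β hβ1 M ((fun (M : ℕ) (u : Literature.MathematicalPhysics.QuantumFieldTheory.Plaquette 4 (M + 1) → ℝ) (p : Literature.MathematicalPhysics.QuantumFieldTheory.Plaquette 4 (M + 1)) => u p - (∑ q : Literature.MathematicalPhysics.QuantumFieldTheory.Plaquette 4 (M + 1), (if q.2 = p.2 then u q else 0)) / (((M : ℝ) + 1) ^ 4)) M u) hvcc hvz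
  -- harmonic part via the infrared bound
  have hIR := hI β hβpos M (fun p : Literature.MathematicalPhysics.QuantumFieldTheory.Plaquette 4 (M + 1) => u p - ((fun (M : ℕ) (u : Literature.MathematicalPhysics.QuantumFieldTheory.Plaquette 4 (M + 1) → ℝ) (p : Literature.MathematicalPhysics.QuantumFieldTheory.Plaquette 4 (M + 1)) => u p - (∑ q : Literature.MathematicalPhysics.QuantumFieldTheory.Plaquette 4 (M + 1), (if q.2 = p.2 then u q else 0)) / (((M : ℝ) + 1) ^ 4)) M u) p)
  have hM1 : (10100 : ℝ) * n ≤ ((M : ℝ) + 1) ^ 4 := by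
    have h1 : (10100 : ℝ) * n ≤ (M : ℝ) := by rw [hn_def]; exact_mod_cast hMB
    have h1le : (1 : ℝ) ≤ (M : ℝ) + 1 := by
      have : (0 : ℝ) ≤ (M : ℝ) := by positivity
      linarith
    have h3 : ((M : ℝ) + 1) ≤ ((M : ℝ) + 1) ^ 4 := by
      calc ((M : ℝ) + 1) = ((M : ℝ) + 1) ^ 1 := (pow_one _).symm
        _ ≤ ((M : ℝ) + 1) ^ 4 := pow_le_pow_right₀ h1le (by norm_num)
    linarith
  have hpow : (0 : ℝ) < ((M : ℝ) + 1) ^ 4 := by positivity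
  have hwB : (∑ p : Literature.MathematicalPhysics.QuantumFieldTheory.Plaquette 4 (M + 1), (((fun p : Literature.MathematicalPhysics.QuantumFieldTheory.Plaquette 4 (M + 1) => u p - ((fun (M : ℕ) (u : Literature.MathematicalPhysics.QuantumFieldTheory.Plaquette 4 (M + 1) → ℝ) (p : Literature.MathematicalPhysics.QuantumFieldTheory.Plaquette 4 (M + 1)) => u p - (∑ q : Literature.MathematicalPhysics.QuantumFieldTheory.Plaquette 4 (M + 1), (if q.2 = p.2 then u q else 0)) / (((M : ℝ) + 1) ^ 4)) M u) p)) p) ^ 2) ≤ n / 10100 := by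
    refine hw.trans ?_
    rw [div_le_div_iff₀ hpow (by norm_num : (0:ℝ) < 10100)]
    have : n ^ 2 * 10100 = n * (10100 * n) := by ring
    rw [this]
    exact mul_le_mul_of_nonneg_left hM1 hn
  -- subadditivity with η = 1/100
  have hsub := hS β M ((fun (M : ℕ) (u : Literature.MathematicalPhysics.QuantumFieldTheory.Plaquette 4 (M + 1) → ℝ) (p : Literature.MathematicalPhysics.QuantumFieldTheory.Plaquette 4 (M + 1)) => u p - (∑ q : Literature.MathematicalPhysics.QuantumFieldTheory.Plaquette 4 (M + 1), (if q.2 = p.2 then u q else 0)) / (((M : ℝ) + 1) ^ 4)) M u) (fun p : Literature.MathematicalPhysics.QuantumFieldTheory.Plaquette 4 (M + 1) => u p - ((fun (M : ℕ) (u : Literature.MathematicalPhysics.QuantumFieldTheory.Plaquette 4 (M + 1) → ℝ) (p : Literature.MathematicalPhysics.QuantumFieldTheory.Plaquette 4 (M + 1)) => u p - (∑ q : Literature.MathematicalPhysics.QuantumFieldTheory.Plaquette 4 (M + 1), (if q.2 = p.2 then u q else 0)) / (((M : ℝ) + 1) ^ 4)) M u) p) (1 / 100) (by norm_num)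
  have hfun2 : (fun p : Literature.MathematicalPhysics.QuantumFieldTheory.Plaquette 4 (M + 1) => ((fun (M : ℕ) (u : Literature.MathematicalPhysics.QuantumFieldTheory.Plaquette 4 (M + 1) → ℝ) (p : Literature.MathematicalPhysics.QuantumFieldTheory.Plaquette 4 (M + 1)) => u p - (∑ q : Literature.MathematicalPhysics.QuantumFieldTheory.Plaquette 4 (M + 1), (if q.2 = p.2 then u q else 0)) / (((M : ℝ) + 1) ^ 4)) M u) p + ((fun p : Literature.MathematicalPhysics.QuantumFieldTheory.Plaquette 4 (M + 1) => u p - ((fun (M : ℕ) (u : Literature.MathematicalPhysics.QuantumFieldTheory.Plaquette 4 (M + 1) → ℝ) (p : Literature.MathematicalPhysics.QuantumFieldTheory.Plaquette 4 (M + 1)) => u p - (∑ q : Literature.MathematicalPhysics.QuantumFieldTheory.Plaquette 4 (M + 1), (if q.2 = p.2 then u q else 0)) / (((M : ℝ) + 1) ^ 4)) M u) p)) p) = u := funext fun p => by simp only []; ring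
  rw [hfun2] at hsub
  have hc := hb₃ β hβ3 M
  have hc0 : (0 : ℝ) ≤ Summit.QuantumFields.YangMills.Theorems.U1Helicity.torusMeanPlaq β M := by linarith
  have hA' := mul_le_mul_of_nonneg_left hA hc0
  have hsubβ : β * ((fun (β : ℝ) (M : ℕ) (w : Literature.MathematicalPhysics.QuantumFieldTheory.Plaquette 4 (M + 1) → ℝ) => Literature.MathematicalPhysics.QuantumFieldTheory.wilsonExpectation (L := M + 1) Literature.MathematicalPhysics.QuantumLattice.u1Rep β (fun U : Literature.MathematicalPhysics.QuantumFieldTheory.GaugeConfig 4 (M + 1) Circle => (∑ p : Literature.MathematicalPhysics.QuantumFieldTheory.Plaquette 4 (M + 1), (w) p * ((Literature.MathematicalPhysics.QuantumFieldTheory.plaquetteHolonomy U p.1 p.2.1.1 p.2.1.2 : Circle) : ℂ).im) ^ 2)) β M u) ≤ (101 / 100 : ℝ) * (β * ((fun (β : ℝ) (M : ℕ) (w : Literature.MathematicalPhysics.QuantumFieldTheory.Plaquette 4 (M + 1) → ℝ) => Literature.MathematicalPhysics.QuantumFieldTheory.wilsonExpectation (L := M + 1) Literature.MathematicalPhysics.QuantumLattice.u1Rep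 β (fun U : Literature.MathematicalPhysics.QuantumFieldTheory.GaugeConfig 4 (M + 1) Circle => (∑ p : Literature.MathematicalPhysics.QuantumFieldTheory.Plaquette 4 (M + 1), (w) p * ((Literature.MathematicalPhysics.QuantumFieldTheory.plaquetteHolonomy U p.1 p.2.1.1 p.2.1.2 : Circle) : ℂ).im) ^ 2)) β M ((fun (M : ℕ) (u : Literature.MathematicalPhysics.QuantumFieldTheory.Plaquette 4 (M + 1) → ℝ) (p : Literature.MathematicalPhysics.QuantumFieldTheory.Plaquette 4 (M + 1)) => u p - (∑ q : Literature.MathematicalPhysics.QuantumFieldTheory.Plaquette 4 (M + 1), (if q.2 = p.2 then u q else 0)) / (((M : ℝ) + 1) ^ 4)) M u)))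
      + 101 * (β * ((fun (β : ℝ) (M : ℕ) (w : Literature.MathematicalPhysics.QuantumFieldTheory.Plaquette 4 (M + 1) → ℝ) => Literature.MathematicalPhysics.QuantumFieldTheory.wilsonExpectation (L := M + 1) Literature.MathematicalPhysics.QuantumLattice.u1Rep β (fun U : Literature.MathematicalPhysics.QuantumFieldTheory.GaugeConfig 4 (M + 1) Circle => (∑ p : Literature.MathematicalPhysics.QuantumFieldTheory.Plaquette 4 (M + 1), (w) p * ((Literature.MathematicalPhysics.QuantumFieldTheory.plaquetteHolonomy U p.1 p.2.1.1 p.2.1.2 : Circle) : ℂ).im) ^ 2)) β M (fun p : Literature.MathematicalPhysics.QuantumFieldTheory.Plaquette 4 (M + 1) => u p - ((fun (M : ℕ) (u : Literature.MathematicalPhysics.QuantumFieldTheory.Plaquette 4 (M + 1) → ℝ) (p : Literature.MathematicalPhysics.QuantumFieldTheory.Plaquette 4 (M + 1)) => u p - (∑ q : Literature.MathematicalPhysics.QuantumFieldTheory.Plaquette 4 (M + 1), (if q.2 = p.2 then u q else 0)) / (((M : ℝ) + 1) ^ 4)) M u) p))) := by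
    have h' := mul_le_mul_of_nonneg_left hsub hβpos.le
    have h'' : β * ((1 + 1 / 100 : ℝ) * ((fun (β : ℝ) (M : ℕ) (w : Literature.MathematicalPhysics.QuantumFieldTheory.Plaquette 4 (M + 1) → ℝ) => Literature.MathematicalPhysics.QuantumFieldTheory.wilsonExpectation (L := M + 1) Literature.MathematicalPhysics.QuantumLattice.u1Rep β (fun U : Literature.MathematicalPhysics.QuantumFieldTheory.GaugeConfig 4 (M + 1) Circle => (∑ p : Literature.MathematicalPhysics.QuantumFieldTheory.Plaquette 4 (M + 1), (w) p * ((Literature.MathematicalPhysics.QuantumFieldTheory.plaquetteHolonomy U p.1 p.2.1.1 p.2.1.2 : Circle) : ℂ).im) ^ 2)) β M ((fun (M : ℕ) (u : Literature.MathematicalPhysics.QuantumFieldTheory.Plaquette 4 (M + 1) → ℝ) (p : Literature.MathematicalPhysics.QuantumFieldTheory.Plaquette 4 (M + 1)) => u p - (∑ q : Literature.MathematicalPhysics.QuantumFieldTheory.Plaquette 4 (M + 1), (if q.2 = p.2 then u q else 0)) / (((M : ℝ) + 1) ^ 4)) M u)) + (1 + 1 / (1 / 100) : ℝ) * ((fun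 (β : ℝ) (M : ℕ) (w : Literature.MathematicalPhysics.QuantumFieldTheory.Plaquette 4 (M + 1) → ℝ) => Literature.MathematicalPhysics.QuantumFieldTheory.wilsonExpectation (L := M + 1) Literature.MathematicalPhysics.QuantumLattice.u1Rep β (fun U : Literature.MathematicalPhysics.QuantumFieldTheory.GaugeConfig 4 (M + 1) Circle => (∑ p : Literature.MathematicalPhysics.QuantumFieldTheory.Plaquette 4 (M + 1), (w) p * ((Literature.MathematicalPhysics.QuantumFieldTheory.plaquetteHolonomy U p.1 p.2.1.1 p.2.1.2 : Circle) : ℂ).im) ^ 2)) β M (fun p : Literature.MathematicalPhysics.QuantumFieldTheory.Plaquette 4 (M + 1) => u p - ((fun (M : ℕ) (u : Literature.MathematicalPhysics.QuantumFieldTheory.Plaquette 4 (M + 1) → ℝ) (p : Literature.MathematicalPhysics.QuantumFieldTheory.Plaquette 4 (M + 1)) => u p - (∑ q : Literature.MathematicalPhysics.QuantumFieldTheory.Plaquette 4 (M + 1), (if q.2 = p.2 then u q else 0)) / (((M : ℝ) + 1) ^ 4)) M u) p)))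
        = (101 / 100 : ℝ) * (β * ((fun (β : ℝ) (M : ℕ) (w : Literature.MathematicalPhysics.QuantumFieldTheory.Plaquette 4 (M + 1) → ℝ) => Literature.MathematicalPhysics.QuantumFieldTheory.wilsonExpectation (L := M + 1) Literature.MathematicalPhysics.QuantumLattice.u1Rep β (fun U : Literature.MathematicalPhysics.QuantumFieldTheory.GaugeConfig 4 (M + 1) Circle => (∑ p : Literature.MathematicalPhysics.QuantumFieldTheory.Plaquette 4 (M + 1), (w) p * ((Literature.MathematicalPhysics.QuantumFieldTheory.plaquetteHolonomy U p.1 p.2.1.1 p.2.1.2 : Circle) : ℂ).im) ^ 2)) β M ((fun (M : ℕ) (u : Literature.MathematicalPhysics.QuantumFieldTheory.Plaquette 4 (M + 1) → ℝ) (p : Literature.MathematicalPhysics.QuantumFieldTheory.Plaquette 4 (M + 1)) => u p - (∑ q : Literature.MathematicalPhysics.QuantumFieldTheory.Plaquette 4 (M + 1), (if q.2 = p.2 then u q else 0)) / (((M : ℝ) + 1) ^ 4)) M u))) + 101 * (β * ((fun (β : ℝ) (M : ℕ) (w : Literature.MathematicalPhysics.QuantumFieldTheory.Plaquette 4 (M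 + 1) → ℝ) => Literature.MathematicalPhysics.QuantumFieldTheory.wilsonExpectation (L := M + 1) Literature.MathematicalPhysics.QuantumLattice.u1Rep β (fun U : Literature.MathematicalPhysics.QuantumFieldTheory.GaugeConfig 4 (M + 1) Circle => (∑ p : Literature.MathematicalPhysics.QuantumFieldTheory.Plaquette 4 (M + 1), (w) p * ((Literature.MathematicalPhysics.QuantumFieldTheory.plaquetteHolonomy U p.1 p.2.1.1 p.2.1.2 : Circle) : ℂ).im) ^ 2)) β M (fun p : Literature.MathematicalPhysics.QuantumFieldTheory.Plaquette 4 (M + 1) => u p - ((fun (M : ℕ) (u : Literature.MathematicalPhysics.QuantumFieldTheory.Plaquette 4 (M + 1) → ℝ) (p : Literature.MathematicalPhysics.QuantumFieldTheory.Plaquette 4 (M + 1)) => u p - (∑ q : Literature.MathematicalPhysics.QuantumFieldTheory.Plaquette 4 (M + 1), (if q.2 = p.2 then u q else 0)) / (((M : ℝ) + 1) ^ 4)) M u) p))) := by ring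
    linarith
  rw [e0]
  nlinarith [hA', hT', hvle, hB, mul_nonneg (sub_nonneg.mpr hc) hn, e1, hsubβ, hIR, hwB]

end Summit.QuantumFields.YangMills.Theorems
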